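import Mathlib
import Summits.PneNP.PneNP.Theorems.OverlapGapAlgebraSearchHardWindowThresholdTails
import Summits.PneNP.PneNP.Theorems.OverlapGapAlgebraSearchHardWindowVanishingRobustSign

/-!
# Route OverlapGapAlgebra, crux `SearchHardWindow` (stmt-PneNP-2460): the THRESHOLD-STATISTIC
# rung — assignments read off by thresholding additive statistics of the formula fail

A new solver class on the rung ladder of the crux (unconditional, no named fact): each output bit
is a THRESHOLD OF AN ADDITIVE STATISTIC of the instance,
  `σ_v(Φ) = [θ_v < Σ_{slots (i,j)} w_v i j (Φ i j)]`,
with ARBITRARY real weights `w_v i j : literals → ℝ` and thresholds `θ_v` (depending on `n`, `v`,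
the slot, the literal — no uniformity, no bound on the weights). The class contains the
majority-polarity vote (`w_v i j (u,b) = ±[u = v]`), every weighted / biased vote over designated
clause positions, and every linear threshold gate over the one-hot or the bit encoding of the
instance (a linear form in the code of slot `(i,j)` is a function of `Φ i j`). It is incomparable
with the classes already on the ladder: unbounded weights are not small de Morgan formulas, and a
vote over all `Θ(n)` occurrences of a variable is neither local nor of low degree.

**Theorem (`thresholdStatisticRung`).** There is `k₀` such that for all `k ≥ k₀` and `ε > 0`,
eventually in `n`, for `m = ⌊5 · 2^k log k / k · n⌋` and EVERY family of weights and thresholds,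
the map `Φ ↦ σ(Φ)` outputs a satisfying assignment of `Φ ∼ F_k(n, m)` for at most `ε · #instances`
instances.

Proof. Peres's theorem, symmetrised to the slot product space (`shwT_truncation_dist_le`,
`…ThresholdTails.lean`): the `±1` output maps have Efron–Stein tails `≤ 4/√d` above every level
`d`, uniformly. Truncate each at the CONSTANT level `d = ⌈(32/(η₀ ε))²⌉ + 1` (`η₀` from
`vanishingLowDegreeRobustSign`): the surrogate `2 · T_{<d}` has coordinate degree `≤ d = o(n/log² n)`,
energy `≤ 4 n · #Inst`, and is saturated with the sign of `σ_v` outside `≤ 16/√d · #Inst` inputs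
per coordinate; by Markov at most `ε/2 · #Inst` inputs have more than `η₀ n` bad coordinates, and
on every other solved input `σ(Φ)` is a satisfying assignment `η₀ n`-close to the saturated sign
pattern of the surrogate — an event of probability `≤ ε/2` by `vanishingLowDegreeRobustSign`
(macro-step overlap gap property + block scan correlation). Corollary `majorityVoteFails`: the
majority-polarity assignment. No new definitions; axioms standard.

References: Y. Peres, arXiv:math/0412377 [Peres2004]; R. O'Donnell 2014, §5.5, Prop. 3.3
[ODonnell2014]; G. Bresler, B. Huang, arXiv:2106.02129, Thm. 2.6 [BreslerHuang2022]; B. Huang,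
M. Sellke, arXiv:2501.06427, Cor. 3.21 [HuangSellke2025].
-/

set_option linter.dupNamespace false -- `Summit.PneNP.PneNP.…`: summit = sub-problem (D-0017)

noncomputable section

namespace Summit.PneNP.PneNP.Theorems

open Finset Filter Asymptotics
open Literature.Computability.Complexity (IsCoordDegreeLE)
open Literature.Probability.Moments
open scoped Classical

/-- A constant level is `o(n / log² n)`. [folklore] -/
theorem shwT_const_isLittleO (d : ℕ) :
    (fun _ : ℕ => (d : ℝ)) =o[atTop] (fun n : ℕ => (n : ℝ) / Real.log n ^ 2) := by
  refine Asymptotics.isLittleO_iff.2 fun c hc => ?_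
  have h := (isLittleO_log_rpow_rpow_atTop (2 : ℝ) (s := 1) one_pos).tendsto_div_nhds_zero
  have h' := h.comp tendsto_natCast_atTop_atTop
  have hev := h'.eventually (gt_mem_nhds (show (0 : ℝ) < c / (d + 1) by positivity))
  filter_upwards [hev, eventually_ge_atTop 2] with n hn hn2
  simp only [Function.comp_apply, Real.rpow_two, Real.rpow_one] at hn
  have hn2R : (2 : ℝ) ≤ n := by exact_mod_cast hn2
  have hnpos : (0 : ℝ) < n := by linarith
  have hlog : 0 < Real.log n := Real.log_pos (by linarith)
  have hlog2 : 0 < Real.log n ^ 2 := by positivity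
  rw [Real.norm_eq_abs, Real.norm_eq_abs, abs_of_nonneg (Nat.cast_nonneg _),
    abs_of_nonneg (by positivity), mul_div_assoc', le_div_iff₀ hlog2]
  rw [div_lt_iff₀ hnpos] at hn
  have hd1 : (0 : ℝ) < d + 1 := by positivity
  have h1 : ((d : ℝ) + 1) * Real.log n ^ 2 < c * n := by
    have := mul_lt_mul_of_pos_left hn hd1
    rwa [show ((d : ℝ) + 1) * (c / (d + 1) * n) = c * n by field_simp] at this
  nlinarith

/-- **The threshold-statistic rung (unconditional).** There is `k₀` such that for all `k ≥ k₀`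
and `ε > 0`, eventually in `n`, with `m = ⌊5 · 2^k log k / k · n⌋`: for EVERY family of real weights
`w v i j : Fin n × Bool → ℝ` and thresholds `θ v`, the assignment
`σ_v(Φ) = [θ v < Σ_i Σ_j w v i j (Φ i j)]` satisfies the instance `Φ` of `F_k(n, m)` for at most
`ε · #instances` instances `Φ`. [cite: Peres2004, Thm. 1] -/
theorem thresholdStatisticRung :
    ∃ k₀ : ℕ, ∀ k : ℕ, k₀ ≤ k → ∀ ε : ℝ, 0 < ε →
      ∀ᶠ n : ℕ in atTop, ∀ m : ℕ, m = ⌊5 * 2 ^ k * Real.log k / k * n⌋₊ →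
        ∀ (w : Fin n → Fin m → Fin k → Fin n × Bool → ℝ) (θ : Fin n → ℝ)
          (g : Fin n → (Fin m → Fin k → Fin n × Bool) → Bool),
          (∀ v Φ, g v Φ = decide (θ v < ∑ i, ∑ j, w v i j (Φ i j))) →
          ((univ.filter fun Φ : Fin m → Fin k → Fin n × Bool =>
              ∀ i : Fin m, ∃ j : Fin k, g (Φ i j).1 Φ = (Φ i j).2).card : ℝ)
            ≤ ε * Fintype.card (Fin m → Fin k → Fin n × Bool) := by
  obtain ⟨k₀, hk₀⟩ := vanishingLowDegreeRobustSign
  refine ⟨k₀, fun k hk ε hε => ?_⟩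
  obtain ⟨η₀, hη₀, hR⟩ := hk₀ k hk
  -- the (constant) truncation level `d`, with `16 / (η₀ √d) ≤ ε / 2`
  set d : ℕ := ⌈(32 / (η₀ * ε)) ^ 2⌉₊ + 1 with hd
  have hd1 : 1 ≤ d := by rw [hd]; omega
  have hdpos : (0 : ℝ) < d := by exact_mod_cast hd1
  have hsqrt : 32 / (η₀ * ε) ≤ Real.sqrt d := by
    have hdR : (32 / (η₀ * ε)) ^ 2 ≤ (d : ℝ) := by
      rw [hd]; push_cast
      linarith [Nat.le_ceil ((32 / (η₀ * ε)) ^ 2)]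
    calc 32 / (η₀ * ε) = Real.sqrt ((32 / (η₀ * ε)) ^ 2) := by
          rw [Real.sqrt_sq (by positivity)]
      _ ≤ Real.sqrt d := Real.sqrt_le_sqrt hdR
  have hsqpos : 0 < Real.sqrt d := Real.sqrt_pos.2 hdpos
  have hlevel : 16 / Real.sqrt d ≤ ε / 2 * η₀ := by
    rw [div_le_iff₀ hsqpos]
    rw [div_le_iff₀ (by positivity)] at hsqrt
    nlinarith
  have hev := hR 4 (by norm_num) (fun _ => d) (shwT_const_isLittleO d) (ε / 2) (half_pos hε)
  filter_upwards [hev, eventually_ge_atTop 1] with n hRn hn1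
  intro m hm w θ g hg
  haveI : Nonempty (Fin n × Bool) := ⟨(⟨0, hn1⟩, true)⟩
  have hnpos : (0 : ℝ) < n := by exact_mod_cast hn1
  -- the output maps on the slot product space `Fin m × Fin k → Fin n × Bool`
  have hg' : ∀ (v : Fin n) (y : Fin m × Fin k → Fin n × Bool), g v (Function.curry y) =
      decide (θ v < ∑ p : Fin m × Fin k, w v p.1 p.2 (y p)) := by
    intro v y
    rw [hg]
    have hs : (∑ i, ∑ j, w v i j (Function.curry y i j)) = ∑ p : Fin m × Fin k, w v p.1 p.2 (y p) := by
      rw [← Fintype.sum_prod_type']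
      rfl
    exact decide_eq_decide.mpr (by rw [hs])
  -- truncations and the surrogate `F Φ v = 2 T_{<d}[(±1)^{g v}] (Φ)`
  set Tr : Fin n → (Fin m × Fin k → Fin n × Bool) → ℝ := fun v y =>
    ∑ S ∈ (univ : Finset (Fin m × Fin k)).powerset.filter (fun S => S.card < d),
      hoeffdingComp S (fun y => if g v (Function.curry y) then (1 : ℝ) else -1) y with hTr
  set F : (Fin m → Fin k → Fin n × Bool) → Fin n → ℝ := fun Φ v =>
    2 * Tr v (Function.uncurry Φ) with hF
  -- (i) coordinate degree `≤ d`
  have hdeg : ∀ v : Fin n, IsCoordDegreeLE d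
      (fun y : Fin m × Fin k → Fin n × Bool => F (Function.curry y) v) := by
    intro v
    have h := (shwT_truncation_isCoordDegreeLE
      (fun y : Fin m × Fin k → Fin n × Bool => if g v (Function.curry y) then (1 : ℝ) else -1) d).smul 2
    have he : (fun y : Fin m × Fin k → Fin n × Bool => F (Function.curry y) v) =
        fun y => 2 * Tr v y := by
      funext y; simp only [hF, Function.uncurry_curry]
    rw [he]
    exact h
  -- (ii) energy `≤ 4 n #Inst`
  have hcardEq : (Fintype.card (Fin m × Fin k → Fin n × Bool) : ℝ) =
      Fintype.card (Fin m → Fin k → Fin n × Bool) := by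
    rw [Fintype.card_congr (Equiv.curry (Fin m) (Fin k) (Fin n × Bool))]
  have henergy : ∑ Φ : Fin m → Fin k → Fin n × Bool, ∑ v : Fin n, F Φ v ^ 2
      ≤ 4 * n * Fintype.card (Fin m → Fin k → Fin n × Bool) := by
    have hG : ∑ Φ : Fin m → Fin k → Fin n × Bool, ∑ v, F Φ v ^ 2 =
        ∑ y : Fin m × Fin k → Fin n × Bool, ∑ v, (2 * Tr v y) ^ 2 :=
      Fintype.sum_equiv (Equiv.curry (Fin m) (Fin k) (Fin n × Bool)).symm _ _ fun Φ => rfl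
    rw [hG, Finset.sum_comm, ← hcardEq]
    calc ∑ v : Fin n, ∑ y : Fin m × Fin k → Fin n × Bool, (2 * Tr v y) ^ 2
        ≤ ∑ _v : Fin n, 4 * (Fintype.card (Fin m × Fin k → Fin n × Bool) : ℝ) := by
          refine Finset.sum_le_sum fun v _ => ?_
          have := shwT_truncation_energy_le
            (fun y : Fin m × Fin k → Fin n × Bool => g v (Function.curry y)) d
          simp only [hTr]
          calc ∑ y : Fin m × Fin k → Fin n × Bool, (2 * ∑ S ∈ (univ : Finset (Fin m × Fin k)).powerset.filter
                (fun S => S.card < d), hoeffdingComp S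
                  (fun y => if g v (Function.curry y) then (1 : ℝ) else -1) y) ^ 2
              = 4 * ∑ y : Fin m × Fin k → Fin n × Bool, (∑ S ∈ (univ : Finset (Fin m × Fin k)).powerset.filter
                (fun S => S.card < d), hoeffdingComp S
                  (fun y => if g v (Function.curry y) then (1 : ℝ) else -1) y) ^ 2 := by
                rw [mul_sum]; exact sum_congr rfl fun y _ => by ring
            _ ≤ _ := by linarith
      _ = 4 * n * (Fintype.card (Fin m × Fin k → Fin n × Bool) : ℝ) := by
          rw [Finset.sum_const, Finset.card_univ, Fintype.card_fin, nsmul_eq_mul]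
          ring
  -- (iii) the sign-robust low-degree bound for `F`
  have hRF := hRn m hm F hdeg henergy
  -- (iv) bad (input, coordinate) pairs: few per coordinate
  set bad : (Fin m → Fin k → Fin n × Bool) → Fin n → Prop := fun Φ v =>
    ¬ (1 ≤ |F Φ v| ∧ decide (0 ≤ F Φ v) = g v Φ) with hbad
  have hbad_v : ∀ v : Fin n, ((univ.filter fun Φ : Fin m → Fin k → Fin n × Bool => bad Φ v).card : ℝ)
      ≤ 16 / Real.sqrt d * Fintype.card (Fin m → Fin k → Fin n × Bool) := by
    intro v
    have hdist := shwT_truncation_dist_le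
      (fun y : Fin m × Fin k → Fin n × Bool => g v (Function.curry y))
      (fun p ℓ => w v p.1 p.2 ℓ) (θ v) (hg' v) d hd1
    rw [← hcardEq]
    -- pointwise: a bad input is `1/2`-far from its truncation
    have hpt : ∀ y : Fin m × Fin k → Fin n × Bool,
        (if bad (Function.curry y) v then (1 : ℝ) else 0) ≤
          4 * ((if g v (Function.curry y) then (1 : ℝ) else -1) - Tr v y) ^ 2 := by
      intro y
      by_cases hb : bad (Function.curry y) v
      · rw [if_pos hb]
        by_contra hlt
        push Not at hlt
        apply hb
        have hFy : F (Function.curry y) v = 2 * Tr v y := by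
          simp only [hF, Function.uncurry_curry]
        rw [hFy]
        cases hgv : g v (Function.curry y)
        · rw [hgv] at hlt
          simp only [Bool.false_eq_true, if_false] at hlt
          have h1 : Tr v y < -1 / 2 := by nlinarith
          refine ⟨?_, ?_⟩
          · rw [abs_of_neg (by linarith)]; linarith
          · simp only [decide_eq_false_iff_not, not_le]; linarith
        · rw [hgv] at hlt
          simp only [if_true] at hlt
          have h1 : 1 / 2 < Tr v y := by nlinarith
          refine ⟨?_, ?_⟩
          · rw [abs_of_pos (by linarith)]; linarith
          · simp only [decide_eq_true_eq]; linarith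
      · rw [if_neg hb]; positivity
    calc ((univ.filter fun Φ : Fin m → Fin k → Fin n × Bool => bad Φ v).card : ℝ)
        = ∑ y : Fin m × Fin k → Fin n × Bool, (if bad (Function.curry y) v then (1 : ℝ) else 0) := by
          rw [card_eq_sum_ones, Nat.cast_sum, sum_filter]
          push_cast
          exact (Fintype.sum_equiv (Equiv.curry (Fin m) (Fin k) (Fin n × Bool)) _ _ fun y => rfl).symm
      _ ≤ ∑ y : Fin m × Fin k → Fin n × Bool,
          4 * ((if g v (Function.curry y) then (1 : ℝ) else -1) - Tr v y) ^ 2 := sum_le_sum fun y _ => hpt y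
      _ ≤ 4 * (4 / Real.sqrt d * Fintype.card (Fin m × Fin k → Fin n × Bool)) := by
          rw [← mul_sum]
          exact mul_le_mul_of_nonneg_left hdist (by norm_num)
      _ = 16 / Real.sqrt d * Fintype.card (Fin m × Fin k → Fin n × Bool) := by ring
  -- (v) Markov: few inputs have more than `η₀ n` bad coordinates
  have hbadsum : ∑ Φ : Fin m → Fin k → Fin n × Bool,
      ((univ.filter fun v : Fin n => bad Φ v).card : ℝ) ≤
      n * (16 / Real.sqrt d * Fintype.card (Fin m → Fin k → Fin n × Bool)) := by
    rw [shwF_sum_card_filter_comm]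
    calc ∑ v : Fin n, ((univ.filter fun Φ : Fin m → Fin k → Fin n × Bool => bad Φ v).card : ℝ)
        ≤ ∑ _v : Fin n, 16 / Real.sqrt d * Fintype.card (Fin m → Fin k → Fin n × Bool) :=
          sum_le_sum fun v _ => hbad_v v
      _ = _ := by rw [sum_const, card_univ, Fintype.card_fin, nsmul_eq_mul]
  have hη₀n : 0 < η₀ * (n : ℝ) := by positivity
  have hBx : ((univ.filter fun Φ : Fin m → Fin k → Fin n × Bool =>
      η₀ * (n : ℝ) < ((univ.filter fun v : Fin n => bad Φ v).card : ℝ)).card : ℝ) ≤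
      ε / 2 * Fintype.card (Fin m → Fin k → Fin n × Bool) := by
    have h1 := (shwF_card_filter_lt_card_le bad (η₀ * (n : ℝ))).trans hbadsum
    refine le_of_mul_le_mul_left (h1.trans ?_) hη₀n
    have hc : (0 : ℝ) ≤ (n : ℝ) * Fintype.card (Fin m → Fin k → Fin n × Bool) := by positivity
    calc (n : ℝ) * (16 / Real.sqrt d * Fintype.card (Fin m → Fin k → Fin n × Bool))
        = 16 / Real.sqrt d * ((n : ℝ) * Fintype.card (Fin m → Fin k → Fin n × Bool)) := by ring
      _ ≤ ε / 2 * η₀ * ((n : ℝ) * Fintype.card (Fin m → Fin k → Fin n × Bool)) :=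
          mul_le_mul_of_nonneg_right hlevel hc
      _ = η₀ * (n : ℝ) * (ε / 2 * Fintype.card (Fin m → Fin k → Fin n × Bool)) := by ring
  -- (vi) solved inputs with few bad coordinates lie in the robust event
  have hgood : ((univ.filter fun Φ : Fin m → Fin k → Fin n × Bool =>
      (∀ i : Fin m, ∃ j : Fin k, g (Φ i j).1 Φ = (Φ i j).2) ∧
      ¬ η₀ * (n : ℝ) < ((univ.filter fun v : Fin n => bad Φ v).card : ℝ)).card : ℝ) ≤
      ε / 2 * Fintype.card (Fin m → Fin k → Fin n × Bool) := by
    refine le_trans ?_ hRF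
    refine Nat.cast_le.2 (Finset.card_le_card fun Φ hΦ => ?_)
    simp only [mem_filter, mem_univ, true_and] at hΦ ⊢
    obtain ⟨hsol, hfew⟩ := hΦ
    rw [not_lt] at hfew
    refine ⟨fun v => g v Φ, hsol, le_trans ?_ hfew⟩
    refine Nat.cast_le.2 (Finset.card_le_card fun v hv => ?_)
    simp only [Finset.mem_filter, Finset.mem_univ, true_and, hbad] at hv ⊢
    rintro ⟨h1, h2⟩
    rcases hv with hv | hv
    · exact absurd h1 (not_le.2 hv)
    · exact hv h2.symm
  -- (vii) conclusion
  have hsplit := shwRung_card_filter_le_and_add_not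
    (fun Φ : Fin m → Fin k → Fin n × Bool => ∀ i : Fin m, ∃ j : Fin k, g (Φ i j).1 Φ = (Φ i j).2)
    (fun Φ => ¬ η₀ * (n : ℝ) < ((univ.filter fun v : Fin n => bad Φ v).card : ℝ))
  have hsplit' := (Nat.cast_le (α := ℝ)).2 hsplit
  rw [Nat.cast_add] at hsplit'
  have hBx' : ((univ.filter fun Φ : Fin m → Fin k → Fin n × Bool =>
      ¬ ¬ η₀ * (n : ℝ) < ((univ.filter fun v : Fin n => bad Φ v).card : ℝ)).card : ℝ) ≤
      ε / 2 * Fintype.card (Fin m → Fin k → Fin n × Bool) := by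
    simp only [not_not]
    exact hBx
  linarith [hsplit', hgood, hBx']

end Summit.PneNP.PneNP.Theorems

end
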